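import Summits.BirchSwinnertonDyer.Rank1Residual.X2.RankZero
import Summits.BirchSwinnertonDyer.Rank1Residual.Partition.CellOf
import Literature.NumberTheory.EllipticCurves.Wuthrich2014.SurjectiveMultiplicativeDivisibility
import Literature.NumberTheory.EllipticCurves.Rank1Residual.Typed.X11
import Literature.NumberTheory.EllipticCurves.Rank1Residual.Typed.KimCertificate
import HarnessLib

/-!
# Class X11a, surjective image: `BSD(E,p)` at a (ram)-free multiplicative prime IMPLIES Mazur's
# main conjecture at that prime — the converse chain (cell `b2b-bsdres`, unit `b2b-bsdres-x11a`, gen 13)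

HONEST FRAMING (run/shared/lean/b2b/bsd-rank1-residual/, verbatim in every file): the goal of the
cell is to DELETE the COMBINATION-SHAPED residual classes of the Birch–Swinnerton-Dyer formula for
ALL analytic-rank `≤ 1` elliptic curves over `ℚ` — "full BSD formula for every rank `≤ 1` curve in
class `C`" assembled STRICTLY from published theorems — so that the rank-`≤ 1` remainder becomes
exactly the CONSTRUCTION-SHAPED classes, which are TYPED (missing-input `Prop`s), NOT attempted.
This is not "finishing BSD". Research routes; NO CLAIM BEYOND STATED CLASSES. Theorems only (no
definition, no named fact): every published theorem enters as an explicit hypothesis — the tree's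
existing NAMED FACTS — or as a tree theorem.

**Setting.** `E/ℚ` (globally minimal `W`), `ord_{s=1} L(E,s) = 0`, a prime `p ≥ 5` of
multiplicative reduction with `ρ̄_{E,p}` surjective: class X11a (`ClassX11a W p := r = 0 ∧ p ≠ 2 ∧
Mult ∧ Irr ∧ ¬Ram`, `Summits/…/Partition/Rows.lean`) on its surjective part, but ALSO row C1 ((ram))
— nothing below uses `¬Ram`. The typed missing input of X11a's leaf (`X11a/Cells.lean`) is Mazur's
main conjecture at the multiplicative prime, eisenstein-p2's class-agnostic `X2.MazurMainConjectureAt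
W p` (every datum `(κ, γ, f, ϖ, D)`: `X(E/ℚ_∞)` torsion, `char_Λ X = (g)`, `ι(T^e·g·w) = ϖ·L_p`,
`w ∈ Λˣ`, `e = 1` split / `0` non-split — the conclusion of Skinner 2016 Thm. A, printed under (ram)).

**Main theorem** (`mazurMainConjectureAt_of_bsdp`, with `X2.bsdp_of_mazurMainConjectureAt_of_analyticRank_eq_zero`
giving `mazurMainConjectureAt_iff_bsdp`): granted the PUBLISHED named facts

| binder | fact (tree decl) | source | status |
|---|---|---|---|
| `hKato` | `Wuthrich2014.kato_charIdeal_dvd_multiplicative_of_surjective` | Kato, Astérisque 295 Thm. 17.4 as recorded by Wuthrich, Doc. Math. 19 (2014) Thm. 3 + p. 382 + Cor. 19 proof (first case) and Stein–Wuthrich 2013 Thm. 7.3: `char_Λ X ∣ ϖ L_p` (`I·char ∣` at split `p`) for SURJECTIVE `ρ_{E,p^∞}`, NO semistability, NO (ram) | PUB, flag `Wu14-surj-attribution` (referee F35) |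
| `hJs`/`hJn` | `SteinWuthrich2013.thm61_{split,nonsplit}Multiplicative` | Stein–Wuthrich, Math. Comp. 82 (2013) Thm. 6.1 (Jones 1989) | PUB |
| `hHs`/`hHn` | `SteinWuthrich2013.exists_isSplitMultCanonical` / `exists_isMultCanonical` | SW 2013 §4.2 | PUB |
| `hGS` | `greenberg_stevens` | Greenberg–Stevens, Invent. Math. 111 (1993); Kobayashi 2006 Cor. 4.2 | PUB |
| `hGZK`, `hmod`, `hpar` | Gross–Zagier–Kolyvagin; modularity (`hasEntireLFunction_rat`, `nonempty_modularParametrizationData`) | bsd.S17; Wiles, BCDT | PUB |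

and the tree THEOREMS `serre_hasSurjectiveModNGaloisRep_pow_holds` (Serre), `LInvariant_ne_zero_holds`,
the MTT interpolation and the Tate-parameter / §4.2-height existence, at every such pair
`BSD(E,p)` ⟹ Mazur's main conjecture at `(E,p)` (`X2.MazurMainConjectureAt W p`) — hence ⟺, and
⟺ `ord_p #Ш(E/ℚ)_an ≤ ord_p #Ш(E/ℚ)` (`Typed.MissingLowerBoundAt`), in the companion file.

The argument is Greenberg's (LNM 1716 §4 pp. 112–113 and §5, closing examples) run with Kato's
INTEGRAL divisibility for surjective image: `g = h · f_E ∈ char_Λ X = (f_E)` with `ι(T^e g) = ϖ L_p`;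
`[T^e]`-coefficients (`L_p(0) = 2[0]⁺_f` non-split, MTT; `[T¹]L_p · log κ(γ) = 𝓛_p[0]⁺_f` split,
Greenberg–Stevens) against Jones's leading term `f_E(0)·(log κ(γ))^e·#tors² = u·(2|𝓛_p)·#Ш[p^∞]·∏c_v`
(SW Thm. 6.1, rank `0`, `Reg_p = 1`) give `ord_p(L(E,1)/Ω_E) = ord_p h(0) + ord_p #Ш + ord_p ∏c_v
- 2 ord_p #tors`, `ord_p h(0) ≥ 0`; `BSD(E,p)` forces `h(0) ∈ ℤ_p^×`, `h ∈ Λ^×`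
(`PowerSeries.isUnit_iff_constantCoeff`). Reducible good-ordinary twin: x1b's
`Wuthrich2014.mainConjecture_of_padicValRat_le`.

Consequences (iff, class-level form, per-pair main-conjecture certificates from Wuthrich Prop. 21 and
from Kim's Kurihara numbers): companion file `X11a/MainConjectureCertificates.lean`. NOT done here:
no class-level deletion (X11a's located gap: très ramifié, `p ∣ #Ш_an`, no (ram)); nothing in rank
`1`; nothing for a non-surjective irreducible image (Wuthrich Cor. 19: "can not be dropped").

References: [GreenbergLNM1716] §4–5; [Wuthrich2014] Thm. 3, Cor. 19, Prop. 21; [SteinWuthrich2013]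
Thm. 6.1, §4.2, Thm. 7.3; [GreenbergStevens1993]; [MazurTateTeitelbaum1986] §I.14–15;
[Skinner2016PacificMC] Thm. A, C; [Miller2011LMS] Def. 1.1.
-/

set_option autoImplicit false

noncomputable section

open scoped Classical MatrixGroups ModularForm

open CongruenceSubgroup WeierstrassCurve Literature.NumberTheory.EllipticCurves
  Literature.NumberTheory.EllipticCurves.ModularForms
  Literature.NumberTheory.EllipticCurves.Rank1Residual
  Literature.NumberTheory.EllipticCurves.Rank1Residual.Typed
  Literature.NumberTheory.EllipticCurves.Wuthrich2014
  Literature.NumberTheory.EllipticCurves.SteinWuthrich2013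

namespace Summit.BirchSwinnertonDyer.Rank1Residual.X11a

/-- Valuation bookkeeping with a cofactor: from `t·#E(ℚ)_tors² = c·v·#Ш[p^∞]·∏ c_v` in `ℚ_p`, `v` a
unit, `c, t ≠ 0`: `ord_p t = ord_p c + ord_p #Ш + ord_p ∏ c_v - 2 ord_p #E(ℚ)_tors` (cofactor version
of x11a gen 8's `Typed.padicValRat_eq_of_torsionSq_mul_eq`). [folklore] -/
theorem padicValRat_eq_of_torsionSq_mul_eq_cofactor (W : WeierstrassCurve ℚ) [W.IsElliptic]
    (p : ℕ) [Fact p.Prime] [Finite W.sha] {t : ℚ} (ht0 : t ≠ 0) (c v : ℚ_[p]) (hc0 : c ≠ 0)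
    (hv : v.valuation = 0) (hv0 : v ≠ 0)
    (key : (t : ℚ_[p]) * (W.torsionOrder : ℚ_[p]) ^ 2 =
      c * v * (Nat.card (AddCommGroup.primaryComponent W.sha p) : ℚ_[p]) *
        (W.tamagawaProduct : ℚ_[p])) :
    padicValRat p t = c.valuation + (padicValNat p W.shaOrder : ℤ) +
      padicValNat p W.tamagawaProduct - 2 * padicValNat p W.torsionOrder := by
  have hpP : p.Prime := Fact.out
  haveI : NeZero p := ⟨hpP.ne_zero⟩
  set Shp : ℚ_[p] := (Nat.card (AddCommGroup.primaryComponent W.sha p) : ℚ_[p]) with hShp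
  obtain ⟨u₅, hu₅⟩ := exists_unit_natCard_eq_mul_card_primaryComponent W.sha p
  have hSha : (W.shaOrder : ℚ_[p]) = ((u₅ : ℤ_[p]) : ℚ_[p]) * Shp := by
    rw [WeierstrassCurve.shaOrder, hShp]
    exact hu₅
  have htQ0 : (t : ℚ_[p]) ≠ 0 := by exact_mod_cast ht0
  have hT0 : (W.torsionOrder : ℚ_[p]) ≠ 0 := by
    exact_mod_cast (W.torsionOrder_pos W.finite_torsion_holds).ne'
  have hSha0 : (W.shaOrder : ℚ_[p]) ≠ 0 := by
    exact_mod_cast (WeierstrassCurve.shaOrder_pos W ‹_›).ne'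
  have htam0 : (W.tamagawaProduct : ℚ_[p]) ≠ 0 := by
    exact_mod_cast (W.tamagawaProduct_pos_holds : 0 < W.tamagawaProduct).ne'
  have key' : (t : ℚ_[p]) * (W.torsionOrder : ℚ_[p]) ^ 2 * ((u₅ : ℤ_[p]) : ℚ_[p]) =
      c * v * (W.shaOrder : ℚ_[p]) * (W.tamagawaProduct : ℚ_[p]) := by
    rw [hSha]
    linear_combination ((u₅ : ℤ_[p]) : ℚ_[p]) * key
  have hval := congrArg Padic.valuation key'
  rw [Padic.valuation_mul (mul_ne_zero htQ0 (pow_ne_zero 2 hT0)) (coe_units_ne_zero p u₅),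
    Padic.valuation_mul htQ0 (pow_ne_zero 2 hT0), Padic.valuation_pow, valuation_coe_units_eq_zero,
    Padic.valuation_mul (mul_ne_zero (mul_ne_zero hc0 hv0) hSha0) htam0,
    Padic.valuation_mul (mul_ne_zero hc0 hv0) hSha0, Padic.valuation_mul hc0 hv0, hv,
    Padic.valuation_ratCast] at hval
  simp only [Padic.valuation_natCast, Nat.cast_ofNat, add_zero] at hval
  linarith

/-! ### The converse at a multiplicative prime with surjective image -/

/-- **`BSD`-type lower bound ⟹ Mazur's main conjecture at a multiplicative `p ≥ 5` with surjective
`ρ̄_{E,p}`, analytic rank `0` (core form).** Hypotheses: the PUBLISHED named facts Kato's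
divisibility for surjective `ρ_{E,p^∞}` at `p ‖ N` (`hKato`), Stein–Wuthrich 2013 Thm. 6.1 at split /
non-split `p` (`hJs`, `hJn`) with the existence of THE §4.2 heights (`hHs`, `hHn`), Greenberg–Stevens
(`hGS`), Gross–Zagier–Kolyvagin (`hGZK`), modularity (`hmod`); data `p ≥ 5` multiplicative,
`ρ̄_{E,p}` surjective, `ord_{s=1}L(E,s) = 0`; and the REVERSE rank-`0` inequality
`ord_p(L(E,1)/Ω_E) ≤ ord_p #Ш + ord_p ∏ c_v - 2 ord_p #E(ℚ)_tors` (`hlow`). Conclusion: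
`X2.MazurMainConjectureAt W p` — at every datum `(κ, γ, f, ϖ, D)`, `X` torsion, `char_Λ X = (f_E)`,
`ι(T^e · f_E · h) = ϖ · L_p` with `h ∈ Λˣ`. Proof: Kato gives `g = h · f_E ∈ (f_E)` with
`ι(T^e g) = ϖ L_p`; `[T^e]`-coefficients (MTT `L_p(0) = 2[0]⁺_f` non-split; Greenberg–Stevens split)
against Jones's leading term for `f_E` (SW Thm. 6.1, `Reg_p = 1`) give
`(L(E,1)/Ω_E)·#tors² = h(0)·u·#Ш[p^∞]·∏c_v` (`𝓛_p ≠ 0` cancelled), so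
`ord_p(L(E,1)/Ω_E) = ord_p h(0) + …`; `hlow` forces `ord_p h(0) = 0`, `h ∈ Λˣ`.
[cite: GreenbergLNM1716, §4 (PDF pp. 112–113) and §5 (closing examples)]
[cite: Wuthrich2014, Thm. 3 (p. 382) and Cor. 19 proof (p. 399)]
[cite: SteinWuthrich2013, Thm. 6.1 (p. 20) and §4.2] [cite: GreenbergStevens1993, Thm. (trivial zero)]
[cite: MazurTateTeitelbaum1986, §I.14–I.15] -/
theorem mazurMainConjectureAt_of_padicValRat_le
    (hKato : kato_charIdeal_dvd_multiplicative_of_surjective)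
    (hJs : thm61_splitMultiplicative) (hJn : thm61_nonsplitMultiplicative)
    (hHs : exists_isSplitMultCanonical) (hHn : exists_isMultCanonical)
    (hGZK : rank_eq_analyticRank_of_analyticRank_le_one) (hmod : hasEntireLFunction_rat)
    (W : WeierstrassCurve ℚ) [W.IsElliptic] [W.IsGloballyMinimal] (p : ℕ) [Fact p.Prime]
    (hGS : greenberg_stevens (W := W) (p := p))
    (hp : 5 ≤ p) (hmult : W.HasMultiplicativeReductionAtPrime p)
    (hsurj : W.HasSurjectiveModNGaloisRep p) (hr : W.analyticRank = 0)
    (hlow : ∀ t : ℚ, W.entireLFunction 1 / (W.realPeriodRat : ℂ) = (t : ℂ) →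
      padicValRat p t ≤ (padicValNat p W.shaOrder : ℤ) + padicValNat p W.tamagawaProduct -
        2 * padicValNat p W.torsionOrder) :
    X2.MazurMainConjectureAt W p := by
  intro κ γ hκ hγ hγ' N _ f hf D ϖ hϖ
  have hpP : p.Prime := Fact.out
  have hp2 : p ≠ 2 := by omega
  haveI : Module.Finite (IwasawaAlgebra p) D.X := D.module_finite_holds hγ
  -- Kato's divisibility (surjective image at every level, by Serre)
  have hsurj' : ∀ n : ℕ, W.HasSurjectiveModNGaloisRep (p ^ n : ℕ) :=
    kato_charIdeal_dvd_multiplicative_of_surjective.surjective_pow_of_five_le W p hp hsurj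
  obtain ⟨hX, hKns, hKs⟩ := hKato W p hp2 hmult hsurj' hκ hγ hγ' hf D ϖ hϖ
  -- a generator `fE` of the (principal) characteristic ideal
  haveI : (Literature.NumberTheory.EllipticCurves.Module.charIdeal (IwasawaAlgebra p) D.X).IsPrincipal :=
    charIdeal_isPrincipal_holds p D.X
  obtain ⟨fE, hfE⟩ := Submodule.IsPrincipal.principal
    (Literature.NumberTheory.EllipticCurves.Module.charIdeal (IwasawaAlgebra p) D.X)
  have hchar : D.charIdeal = Ideal.span {fE} := hfE
  -- rank `0`: `L(E,1) ≠ 0`, `E(ℚ)` and `Ш` finite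
  have hL1 : W.entireLFunction 1 ≠ 0 := (W.analyticRank_eq_zero_iff_holds (hmod W)).1 hr
  obtain ⟨hrank, hfin⟩ := hGZK W (by omega)
  have hr0 : W.mordellWeilRank = 0 := by rw [hrank, hr]
  haveI : Finite W.toAffine.Point := W.mordellWeilRank_eq_zero_iff_finite.mp hr0
  haveI : Finite W.sha := hfin
  haveI : Finite (AddCommGroup.primaryComponent W.sha p) := inferInstance
  -- the rational `t = ϖ · [0]⁺_f = L(E,1)/Ω_E ≠ 0` and the reverse inequality at `t`
  have hΩpos : 0 < W.realPeriodRat := W.realPeriodRat_pos_holds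
  have hϖ0 : ϖ ≠ 0 := by
    rintro rfl
    have hper : 0 < plusPeriod f := IsNewform0.plusPeriod_pos_holds hf.1 hf.coeffField_eq_bot
    rw [← hϖ, Rat.cast_zero, zero_mul] at hper
    exact lt_irrefl _ hper
  set s : ℚ := ratPlusSymbol f 0 with hs_def
  set t : ℚ := ϖ * s with ht_def
  have hLval : W.entireLFunction 1 = (((s : ℝ) * plusPeriod f : ℝ) : ℂ) := hf.entireLFunction_one_eq
  have hq : W.entireLFunction 1 / (W.realPeriodRat : ℂ) = ((t : ℚ) : ℂ) := by
    rw [hLval, ← hϖ, div_eq_iff (Complex.ofReal_ne_zero.mpr hΩpos.ne'), ht_def]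
    push_cast
    ring
  have hs0 : s ≠ 0 := by
    intro h0
    apply hL1
    rw [hLval, h0]
    simp
  have ht0 : t ≠ 0 := mul_ne_zero hϖ0 hs0
  have htcast : ((t : ℚ) : ℚ_[p]) = (ϖ : ℚ_[p]) * (s : ℚ_[p]) := by
    rw [ht_def]; push_cast; ring
  have hle := hlow t hq
  -- how a cofactor `h` with the valuation identity becomes a unit
  have unit_of_key : ∀ (h : IwasawaAlgebra p) (u : ℤ_[p]ˣ),
      PowerSeries.constantCoeff h ≠ 0 →
      (t : ℚ_[p]) * (W.torsionOrder : ℚ_[p]) ^ 2 =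
        ((PowerSeries.constantCoeff h : ℤ_[p]) : ℚ_[p]) * ((u : ℤ_[p]) : ℚ_[p]) *
          (Nat.card (AddCommGroup.primaryComponent W.sha p) : ℚ_[p]) * (W.tamagawaProduct : ℚ_[p]) →
      IsUnit h := by
    intro h u hh00 key
    set h0 : ℚ_[p] := ((PowerSeries.constantCoeff h : ℤ_[p]) : ℚ_[p]) with hh0
    have hh0ne : h0 ≠ 0 := by
      rw [hh0]
      intro h0'
      exact hh00 (by exact_mod_cast (PadicInt.coe_eq_zero.mp h0'))
    have hh0val : 0 ≤ h0.valuation := by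
      rw [hh0]
      exact PadicInt.valuation_coe_nonneg
    have hval := padicValRat_eq_of_torsionSq_mul_eq_cofactor W p ht0 h0 _ hh0ne
      (valuation_coe_units_eq_zero p u) (coe_units_ne_zero p u) key
    have hh0zero : h0.valuation = 0 := by linarith
    have hvalh : (PowerSeries.constantCoeff h : ℤ_[p]).valuation = 0 := by
      have h' : (((PowerSeries.constantCoeff h : ℤ_[p]) : ℚ_[p])).valuation = 0 := by
        rw [← hh0]; exact hh0zero
      rw [PadicInt.valuation_coe] at h'
      exact_mod_cast h'
    have hunit0 : IsUnit (PowerSeries.constantCoeff h : ℤ_[p]) := by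
      rw [PadicInt.isUnit_iff, PadicInt.norm_eq_zpow_neg_valuation hh00, hvalh]
      simp
    exact PowerSeries.isUnit_iff_constantCoeff.mpr hunit0
  refine ⟨hX, fE, hchar, fun hsplit L hL => ?_, fun hns L hL => ?_⟩
  · /- SPLIT multiplicative `p`: Kato gives `g = h · fE` with `ι(T · g) = ϖ · L`; compare
      `[T¹]`-coefficients (Greenberg–Stevens) with SW Thm. 6.1 (split, rank 0). -/
    obtain ⟨g, hgmem, hιg⟩ := hKs hsplit L hL
    have hgmem' : g ∈ Ideal.span {fE} := by rw [← hchar]; exact hgmem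
    obtain ⟨h, hgh⟩ := Ideal.mem_span_singleton'.mp hgmem'
    -- data: Tate parameter, THE §4.2 height, `Reg_p = 1`, Schneider trivial
    obtain ⟨Dq⟩ := (nonempty_tateParameterData_iff_holds (W := W) (p := p)).mpr hsplit
    obtain ⟨Dh, hDh⟩ := hHs W p hp2 Dq
    have hReg : padicRegulator Dh = 1 := padicRegulator_eq_one_of_finite W p Dh
    have hSch : SchneiderConjecture Dh := by
      rw [SchneiderConjecture, hReg]
      exact one_ne_zero
    -- SW Thm. 6.1 (split) for the generator `fE`
    obtain ⟨-, -, h3⟩ := hJs W p hp2 Dq κ γ hκ hγ hγ' D hX fE hchar Dh hDh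
    obtain ⟨u, hu⟩ := h3 hSch inferInstance
    simp only [hr0, zero_add, pow_one, hReg, mul_one, PowerSeries.coeff_zero_eq_constantCoeff] at hu
    -- Greenberg–Stevens
    obtain ⟨-, hGS1⟩ := hGS Dq hf hL
    have h𝓛0 : LInvariant Dq ≠ 0 := LInvariant_ne_zero_holds Dq
    -- `[T¹] ι(T · g) = g(0) = ϖ · [T¹] L`
    have h1 : ((PowerSeries.constantCoeff g : ℤ_[p]) : ℚ_[p]) =
        ((ϖ : ℚ) : ℚ_[p]) * PowerSeries.coeff 1 L := by
      have h := congrArg (PowerSeries.coeff 1) hιg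
      rw [iwasawaToPowerSeries, PowerSeries.coeff_map, PowerSeries.coeff_succ_X_mul,
        PowerSeries.coeff_zero_eq_constantCoeff, PowerSeries.coeff_C_mul] at h
      exact h
    -- `g(0) = h(0) · fE(0)`
    have hg0 : ((PowerSeries.constantCoeff g : ℤ_[p]) : ℚ_[p]) =
        ((PowerSeries.constantCoeff h : ℤ_[p]) : ℚ_[p]) *
          ((PowerSeries.constantCoeff fE : ℤ_[p]) : ℚ_[p]) := by
      rw [← hgh, map_mul]; push_cast; ring
    -- `g(0) ≠ 0` (since `[T¹]L · log = 𝓛 · s ≠ 0`), hence `h(0) ≠ 0`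
    have hsQ0 : (s : ℚ_[p]) ≠ 0 := by exact_mod_cast hs0
    have hc1 : PowerSeries.coeff 1 L ≠ 0 := by
      intro h0
      rw [h0, zero_mul] at hGS1
      exact (mul_ne_zero h𝓛0 hsQ0) hGS1.symm
    have hϖQ0 : ((ϖ : ℚ) : ℚ_[p]) ≠ 0 := by exact_mod_cast hϖ0
    have hh00 : PowerSeries.constantCoeff h ≠ 0 := by
      intro h0
      have : ((PowerSeries.constantCoeff g : ℤ_[p]) : ℚ_[p]) = 0 := by
        rw [hg0, h0, PadicInt.coe_zero, zero_mul]
      rw [h1] at this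
      exact (mul_ne_zero hϖQ0 hc1) this
    -- the identity `t · #tors² = h(0) · u · #Ш[p^∞] · ∏ c_v` (cancel `𝓛_p`)
    have key : (t : ℚ_[p]) * (W.torsionOrder : ℚ_[p]) ^ 2 =
        ((PowerSeries.constantCoeff h : ℤ_[p]) : ℚ_[p]) * ((u : ℤ_[p]) : ℚ_[p]) *
          (Nat.card (AddCommGroup.primaryComponent W.sha p) : ℚ_[p]) *
            (W.tamagawaProduct : ℚ_[p]) := by
      apply mul_left_cancel₀ h𝓛0
      rw [htcast]
      linear_combination (-(((ϖ : ℚ) : ℚ_[p]) * (W.torsionOrder : ℚ_[p]) ^ 2)) * hGS1 -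
        (padicLog p (cyclotomicGenerator p) * (W.torsionOrder : ℚ_[p]) ^ 2) * h1 +
        (padicLog p (cyclotomicGenerator p) * (W.torsionOrder : ℚ_[p]) ^ 2) * hg0 +
        ((PowerSeries.constantCoeff h : ℤ_[p]) : ℚ_[p]) * hu
    have hunit : IsUnit h := unit_of_key h u hh00 key
    refine ⟨hunit.unit, ?_⟩
    rw [IsUnit.unit_spec, show (PowerSeries.X : IwasawaAlgebra p) * fE * h = PowerSeries.X * g by
      rw [← hgh]; ring]
    exact hιg
  · /- NON-SPLIT multiplicative `p`: Kato gives `g = h · fE` with `ι(g) = ϖ · L`; compare constant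
      coefficients (`L(0) = 2[0]⁺_f`) with SW Thm. 6.1 (non-split, rank 0). -/
    obtain ⟨g, hgmem, hιg⟩ := hKns hns L hL
    have hgmem' : g ∈ Ideal.span {fE} := by rw [← hchar]; exact hgmem
    obtain ⟨h, hgh⟩ := Ideal.mem_span_singleton'.mp hgmem'
    -- data: Tate parameter, THE §4.2 height, `Reg_p = 1`, Schneider trivial
    obtain ⟨q, ⟨hq0, hq1, hqj⟩, -⟩ := existsUnique_tateJ_eq_of_one_lt_norm
      (one_lt_norm_j_of_hasMultiplicativeReductionAtPrime (W := W) (p := p) hmult)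
    obtain ⟨Dh, hDh⟩ := hHn W p hp2 hmult hns q hq0 hq1 hqj
    have hReg : padicRegulator Dh = 1 := padicRegulator_eq_one_of_finite W p Dh
    have hSch : SchneiderConjecture Dh := by
      rw [SchneiderConjecture, hReg]
      exact one_ne_zero
    -- SW Thm. 6.1 (non-split) for the generator `fE`
    obtain ⟨-, -, h3⟩ := hJn W p hp2 hmult hns q hq0 hq1 hqj κ γ hκ hγ hγ' D hX fE hchar Dh hDh
    obtain ⟨u, hu⟩ := h3 hSch inferInstance
    simp only [hr0, pow_zero, mul_one, hReg, PowerSeries.coeff_zero_eq_constantCoeff] at hu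
    -- constant coefficients: `g(0) = ϖ · L(0) = ϖ · 2 [0]⁺_f`
    have hL0 : PowerSeries.constantCoeff L = 2 * (s : ℚ_[p]) := hL.constantCoeff_of_neg_one
    have h1 : ((PowerSeries.constantCoeff g : ℤ_[p]) : ℚ_[p]) =
        ((ϖ : ℚ) : ℚ_[p]) * (2 * (s : ℚ_[p])) := by
      have h := congrArg PowerSeries.constantCoeff hιg
      rw [constantCoeff_iwasawaToPowerSeries, map_mul, PowerSeries.constantCoeff_C, hL0] at h
      exact h
    -- `g(0) = h(0) · fE(0)`
    have hg0 : ((PowerSeries.constantCoeff g : ℤ_[p]) : ℚ_[p]) =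
        ((PowerSeries.constantCoeff h : ℤ_[p]) : ℚ_[p]) *
          ((PowerSeries.constantCoeff fE : ℤ_[p]) : ℚ_[p]) := by
      rw [← hgh, map_mul]; push_cast; ring
    have hsQ0 : (s : ℚ_[p]) ≠ 0 := by exact_mod_cast hs0
    have hϖQ0 : ((ϖ : ℚ) : ℚ_[p]) ≠ 0 := by exact_mod_cast hϖ0
    have hh00 : PowerSeries.constantCoeff h ≠ 0 := by
      intro h0
      have : ((PowerSeries.constantCoeff g : ℤ_[p]) : ℚ_[p]) = 0 := by
        rw [hg0, h0, PadicInt.coe_zero, zero_mul]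
      rw [h1] at this
      exact (mul_ne_zero hϖQ0 (mul_ne_zero two_ne_zero hsQ0)) this
    -- the identity `t · #tors² = h(0) · u · #Ш[p^∞] · ∏ c_v` (cancel `2`)
    have key : (t : ℚ_[p]) * (W.torsionOrder : ℚ_[p]) ^ 2 =
        ((PowerSeries.constantCoeff h : ℤ_[p]) : ℚ_[p]) * ((u : ℤ_[p]) : ℚ_[p]) *
          (Nat.card (AddCommGroup.primaryComponent W.sha p) : ℚ_[p]) *
            (W.tamagawaProduct : ℚ_[p]) := by
      apply mul_left_cancel₀ (two_ne_zero : (2 : ℚ_[p]) ≠ 0)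
      rw [htcast]
      linear_combination (-((W.torsionOrder : ℚ_[p]) ^ 2)) * h1 +
        ((W.torsionOrder : ℚ_[p]) ^ 2) * hg0 +
        ((PowerSeries.constantCoeff h : ℤ_[p]) : ℚ_[p]) * hu
    have hunit : IsUnit h := unit_of_key h u hh00 key
    refine ⟨hunit.unit, ?_⟩
    rw [IsUnit.unit_spec, show fE * h = g by rw [← hgh]; ring]
    exact hιg

/-- **`ord_p #Ш(E/ℚ)_an ≤ ord_p #Ш(E/ℚ)` ⟹ Mazur's main conjecture at `(E,p)`** (multiplicative
`p ≥ 5`, `ρ̄_{E,p}` surjective, analytic rank `0`; same facts). The hypothesis is the cell's typed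
lower bound `Typed.MissingLowerBoundAt W p`; `#Ш_an = (L(E,1)/Ω_E)·#E(ℚ)²/∏c_v`
(`shaAn_eq_of_L_one_div_eq`) converts it to the reverse inequality of the core form.
[cite: GreenbergLNM1716, §4 (PDF pp. 112–113) and §5 (closing examples)]
[cite: Wuthrich2014, Thm. 3 (p. 382) and Cor. 19 proof (p. 399)] [cite: Miller2011LMS, Def. 1.1] -/
theorem mazurMainConjectureAt_of_missingLowerBoundAt
    (hKato : kato_charIdeal_dvd_multiplicative_of_surjective)
    (hJs : thm61_splitMultiplicative) (hJn : thm61_nonsplitMultiplicative)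
    (hHs : exists_isSplitMultCanonical) (hHn : exists_isMultCanonical)
    (hGZK : rank_eq_analyticRank_of_analyticRank_le_one) (hmod : hasEntireLFunction_rat)
    (W : WeierstrassCurve ℚ) [W.IsElliptic] [W.IsGloballyMinimal] (p : ℕ) [Fact p.Prime]
    (hGS : greenberg_stevens (W := W) (p := p))
    (hp : 5 ≤ p) (hmult : W.HasMultiplicativeReductionAtPrime p)
    (hsurj : W.HasSurjectiveModNGaloisRep p) (hr : W.analyticRank = 0)
    (hlow : MissingLowerBoundAt W p) : X2.MazurMainConjectureAt W p := by
  have hL : W.entireLFunction 1 ≠ 0 := (W.analyticRank_eq_zero_iff_holds (hmod W)).1 hr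
  refine mazurMainConjectureAt_of_padicValRat_le hKato hJs hJn hHs hHn hGZK hmod W p hGS hp hmult
    hsurj hr ?_
  intro q hq
  obtain ⟨-, hE, -, hshaAn⟩ := shaAn_eq_of_L_one_div_eq hGZK W hL hq
  haveI := hE
  obtain ⟨q', hq', hle'⟩ := hlow
  have hqq : q' = q * (Nat.card W.toAffine.Point : ℚ) ^ 2 / (W.tamagawaProduct : ℚ) := by
    exact_mod_cast hq'.symm.trans hshaAn
  have hΩ : (W.realPeriodRat : ℂ) ≠ 0 := by exact_mod_cast W.realPeriodRat_pos_holds.ne'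
  have hq0 : q ≠ 0 := by
    rintro rfl
    apply hL
    rw [Rat.cast_zero, div_eq_zero_iff] at hq
    exact hq.resolve_right hΩ
  have hcard : (Nat.card W.toAffine.Point : ℚ) ≠ 0 := by
    exact_mod_cast (Nat.card_pos (α := W.toAffine.Point)).ne'
  have htam : (W.tamagawaProduct : ℚ) ≠ 0 := by
    exact_mod_cast (W.tamagawaProduct_pos_holds : 0 < W.tamagawaProduct).ne'
  have hcardT : (Nat.card W.toAffine.Point : ℚ) = (W.torsionOrder : ℚ) := by
    exact_mod_cast (W.torsionOrder_eq_natCard_of_finite).symm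
  rw [hqq, padicValRat.div (mul_ne_zero hq0 (pow_ne_zero 2 hcard)) htam,
    padicValRat.mul hq0 (pow_ne_zero 2 hcard), padicValRat.pow, hcardT] at hle'
  simp only [padicValRat.of_nat, Nat.cast_ofNat] at hle'
  linarith

/-- **`BSD(E,p)` ⟹ Mazur's main conjecture at `(E,p)`** (multiplicative `p ≥ 5`, `ρ̄_{E,p}`
surjective, analytic rank `0`; same facts): Miller's `BSDp W p` contains `ord_p #Ш_an = ord_p #Ш(p)`,
i.e. (finite `Ш`) the typed output `MissingPPartAt W p`, whose lower half feeds
`mazurMainConjectureAt_of_missingLowerBoundAt`. So every certified instance of the rank-`0` BSD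
formula at such a prime is an instance of Mazur's main conjecture at a multiplicative prime proved
from the published record — with or without (ram). [cite: GreenbergLNM1716, §4 (PDF pp. 112–113) and §5 (closing examples)]
[cite: Wuthrich2014, Thm. 3 (p. 382) and Cor. 19 proof (p. 399)] [cite: Miller2011LMS, Def. 1.1] -/
theorem mazurMainConjectureAt_of_bsdp
    (hKato : kato_charIdeal_dvd_multiplicative_of_surjective)
    (hJs : thm61_splitMultiplicative) (hJn : thm61_nonsplitMultiplicative)
    (hHs : exists_isSplitMultCanonical) (hHn : exists_isMultCanonical)
    (hGZK : rank_eq_analyticRank_of_analyticRank_le_one) (hmod : hasEntireLFunction_rat)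
    (W : WeierstrassCurve ℚ) [W.IsElliptic] [W.IsGloballyMinimal] (p : ℕ) [Fact p.Prime]
    (hGS : greenberg_stevens (W := W) (p := p))
    (hp : 5 ≤ p) (hmult : W.HasMultiplicativeReductionAtPrime p)
    (hsurj : W.HasSurjectiveModNGaloisRep p) (hr : W.analyticRank = 0) (hbsd : BSDp W p) :
    X2.MazurMainConjectureAt W p := by
  haveI : Finite W.sha := (hGZK W (by rw [hr]; exact zero_le_one)).2
  exact mazurMainConjectureAt_of_missingLowerBoundAt hKato hJs hJn hHs hHn hGZK hmod W p hGS hp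
    hmult hsurj hr (lower_and_upper_of_missingPPartAt W p (missingPPartAt_of_bsdp W p hbsd)).1

end Summit.BirchSwinnertonDyer.Rank1Residual.X11a

end
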